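import Literature.MathematicalPhysics.QuantumFieldTheory.Balaban1983to89.B4Lower18RegularRegion

/-!
# [B4] (1.6): the Green's function `G_k(Ω, A) = (−Δ^{η,N}_{A,Ω} + m² + aP_k(A))^{-1}` EXISTS FOR EVERY
CONFIGURATION `A` — the operator of (1.6) is positive definite on every finite union of unit blocks, for every
vector field, every orthogonal one-parameter flow, every `a > 0` and every `m² ≥ 0`

T. Bałaban, *Regularity and decay of lattice Green's functions*, Commun. Math. Phys. **89** (1983) 571–597
[Balaban1983RegularityDecay] (= [B4]; journal page = PDF page + 570).

statement-level skeleton of published theorems with citation tags; proofs where landed; nothing here is a claim about the Yang–Mills mass gap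

PDF held: `paper:balaban1983-cmp89-regularity-decay` (p. 572 = PDF p. 2 read this session with `lit read`; the
displays (1.2)–(1.6) are the ones transcribed verbatim in the header of `B4GaugeCovariance`).

WHAT IS REPRODUCED = SKELETON row **B4.Eq1.6** (owner r01), unit `lit-balaban-p35` gen 4 (Phase-2 proof seat,
free-target protocol G.5-34(d); HOME `run/shared/lean/pub/lit-balaban/`).  The print, p. 572 [PDF 2], verbatim:
«Our fundamental Green's function is a kernel of the operator (1.6) `G_k(Ω, A) = (−Δ^{η,N}_{A,Ω} + m² + aP_k(A))^{−1}`,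
where `m² ≥ 0` and `a` is a positive constant close to 1. We consider all these operators under the assumption that
the vector field `A` is regular on `Ω` in the sense that» (1.7) «`|(∂^η_μA)(x)| ≤ ce^{β−1}`, …».  The display DEFINES
`G_k(Ω, A)` as an inverse; the tree's `B4GaugeCovariance.green`/`b4Green` is Mathlib's nonsingular inverse `(…)⁻¹`
(value unspecified when the operator is singular), and up to now the operator was known to be invertible only
where the quantitative bound (1.8) had been proved — at `A = 0`
(`B4Claim18Zero`, `B4Lower18.fineOpR_isUnit`), for REGULAR configurations (`B4Lower18Regular.green_box_l2_bound`,
`B4Lower18RegularRegion.green_region_l2_bound`: small field, via (1.8)) — or on the whole torus of the (Higgs)₂,₃ carriers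
(`B1Eq243HiggsModel.isUnit_covOpK_univ`).

WHAT IS PROVED HERE (0 sorry, standard axioms, no new definitions, no hypothesis on the size of `A`): the
operator of (1.6) is POSITIVE DEFINITE — hence invertible, with `G_k(Ω, A)` its honest two-sided inverse, itself
positive definite — for EVERY configuration.  The mechanism (ours; elementary, the paper does not pause on it):
by (1.3) and (1.5), `⟨Φ, (−Δ^{η,N}_{A,Ω} + m² + aP_k(A))Φ⟩ = Σ_{b⊂Ω} η^{d−2}|U(A_b)φ(b₊) − φ(b₋)|² + m²‖Φ‖² +
a‖Q_k(A)Φ‖² ≥ 0`, and it vanishes only if `φ` is covariantly constant along every bond of `Ω` AND all covariant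
block averages `(Q_k(A)φ)(y)` vanish; transporting along the block contours `Γ^{(k)}_{y,x}` (which run through
bonds of the block and end at `x`) turns `U(A(Γ_{y,x}))φ(x)` into `φ(y)`, so `(Q_k(A)φ)(y) = φ(y)·Σ_{x∈B^k(y)}η^d`,
whence `φ(y) = 0` at every block base point and then `φ ≡ 0` on the block (the transporters are orthogonal).

* §1 (abstract, over the block calculus of `B4GaugeCovariance`: sites `X`, block labels `Y`, colours `ι`, bond
  weights `c`, block weights `q`, link variables `W`, contour system `(emb, Γ)`): `transport_mulVec_eq_of_pathRel`
  (transport of a covariantly constant field along a contour returns its value at the start),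
  `transport_transpose_mul_self` (transport along orthogonal links is orthogonal), `covOp_form_nonneg`,
  `covOp_form_eq_zero` (the two zero-mode conditions), **`eq_zero_of_covOp_form_eq_zero`** and
  **`covOp_posDef`**: `H = −Δ_W + m² + a·Q*Q` is positive definite whenever `c ≥ 0`, `q ≥ 0`, `m² ≥ 0`, `a > 0`,
  the links are orthogonal on weighted pairs, every site carries a positive block weight, and each weighted
  contour `Γ_{y,x}` consists of positively weighted steps and ends at `x` (invertibility: `Matrix.PosDef.isUnit`).
* §2 ([B4]'s objects (1.2)–(1.6), `b4Op`/`b4Green` for the link variables `U(κA_b)` of an orthogonal flow):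
  `b4Op_posDef`, `b4Op_isUnit`, `b4Green_mul_b4Op`, `b4Op_mul_b4Green`, `b4Green_posDef` under the same
  geometric hypotheses on weights and contours — for EVERY bond function `A` and every `κ`.
* §3 (the regular-region family of `B4Lower18RegularRegion`: `Ω = fineDom n Ωc` an arbitrary finite union of unit
  blocks of `ηℤ^{d+1}` in lattice units, Neumann weights `regWt`, block weights `rBlkWt`, base points `rbaseEmb`,
  staircase contours `rstairContour`, coefficient `a·n^{−(d+1)}`): ALL hypotheses discharged —
  **`b4Op_region_posDef`**, `b4Op_region_form_pos`, `b4Op_region_isUnit`, **`b4Green_region_mul_b4Op`**,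
  `b4Op_region_mul_b4Green`, `b4Green_region_mulVec_b4Op`, `b4Op_region_mulVec_b4Green` (so `Φ = G_k(Ω,A)f`
  solves `(−Δ^{η,N}_{A,Ω} + m² + aP_k(A))Φ = f` and is the only solution), `b4Green_region_posDef` — for every
  `n ≥ 1`, every finite `Ωc`, every `A`, every flow `F`, every `κ`, every `a > 0`, `m² ≥ 0`.

HONEST SCOPE.  (a) Qualitative: positive definiteness, no lower bound uniform in `η, Ω, A` (that is (1.8), which
needs the regularity (1.7) under which the paper considers these operators, and is the business of `B4Lower18*`);
the point recorded here is that the inverse in (1.6) exists with NO smallness or regularity assumption on `A`, also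
at `m² = 0` — an elementary remark of ours, not a statement printed in [B4].  (b) Geometry as in the `B4*` lineage: finite unions of UNIT blocks of
`ℤ^{d+1} ≅ ηℤ^{d+1}` (containing [B4]'s unions of big blocks), not the torus.  (c) Link variables in one orthogonal
one-parameter group (= [B4]'s (1.2) `U(A) = e^{qeηA}`); §1 is stated for arbitrary orthogonal links.  (d) No
statement of the paper is weakened or asserted beyond (1.6) being a definition of an inverse that exists.
-/

namespace Literature.MathematicalPhysics.QuantumFieldTheory.Balaban1983to89.B4Eq16GreenExists

open Matrix Finset
open Literature.MathematicalPhysics.QuantumFieldTheory.Balaban1983to89.B4GaugeCovariance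
open Literature.MathematicalPhysics.QuantumFieldTheory.Balaban1983to89.B4Lower18Regular
  (PathRel covOp_form fieldLink_orth dotProduct_self_nonneg')
open Literature.MathematicalPhysics.QuantumFieldTheory.Balaban1983to89.B4Lower18RegularRegion

/-! ## §1 The abstract zero-mode analysis of `H = −Δ_W + m² + a·Q*Q` -/

section Generic

variable {X Y ι : Type*}

/-- TRANSPORT OF A COVARIANTLY CONSTANT FIELD along [B4]'s contour transporters `U(A(Γ))` of (1.4): if
`W(u,v)φ(v) = φ(u)` along every step of the contour `Γ`, then `U(Γ)φ(end Γ) = φ(start Γ)`.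
[cite: Balaban1983RegularityDecay, p. 572 (1.4)] -/
theorem transport_mulVec_eq_of_pathRel [Fintype ι] [DecidableEq ι] (W : X → X → Matrix ι ι ℝ)
    (φ : X → ι → ℝ) : ∀ (x : X) (l : List X), PathRel (fun u v => W u v *ᵥ φ v = φ u) x l →
      transport W x l *ᵥ φ (pathEnd x l) = φ x := by
  intro x l
  induction l generalizing x with
  | nil => intro _; simp [transport, pathEnd]
  | cons y l ih =>
      rintro ⟨hxy, hl⟩
      rw [transport, pathEnd, ← Matrix.mulVec_mulVec, ih y hl, hxy]

/-- the contour transporters `U(A(Γ))` of (1.4) along ORTHOGONAL link variables are orthogonal: `U(Γ)ᵀU(Γ) = 1`.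
[cite: Balaban1983RegularityDecay, p. 572 (1.2), (1.4)] -/
theorem transport_transpose_mul_self [Fintype ι] [DecidableEq ι] (W : X → X → Matrix ι ι ℝ) :
    ∀ (x : X) (l : List X), PathRel (fun u v => (W u v)ᵀ * W u v = 1) x l →
      (transport W x l)ᵀ * transport W x l = 1 := by
  intro x l
  induction l generalizing x with
  | nil => intro _; simp [transport]
  | cons y l ih =>
      rintro ⟨hxy, hl⟩
      rw [transport, Matrix.transpose_mul, Matrix.mul_assoc, ← Matrix.mul_assoc (W x y)ᵀ, hxy, Matrix.one_mul,
        ih y hl]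

/-- an orthogonal matrix kills only the zero vector (private plumbing). [folklore] -/
private theorem eq_zero_of_orthogonal_mulVec_eq_zero [Fintype ι] [DecidableEq ι] {O : Matrix ι ι ℝ}
    (hO : Oᵀ * O = 1) {v : ι → ℝ} (hv : O *ᵥ v = 0) : v = 0 := by
  have h : (Oᵀ * O) *ᵥ v = 0 := by rw [← Matrix.mulVec_mulVec, hv, Matrix.mulVec_zero]
  rw [hO, Matrix.one_mulVec] at h
  exact h

/-- a field on `X × ι` vanishes if all its site values `φ(x) ∈ ℝ^ι` vanish (private plumbing). [folklore] -/
private theorem eq_zero_of_fld_eq_zero {Φ : X × ι → ℝ} (h : ∀ x, fld Φ x = 0) : Φ = 0 := by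
  funext p
  exact congrFun (h p.1) p.2

/-- **THE FORM OF (1.6) IS NON-NEGATIVE**: `⟨Φ, (−Δ_W + m² + aQ*Q)Φ⟩ ≥ 0` for `c ≥ 0`, `m² ≥ 0`, `a ≥ 0`
((1.3): a sum of squares; (1.5): `⟨Φ, PΦ⟩ = |QΦ|²`). [cite: Balaban1983RegularityDecay, p. 572 (1.3), (1.5), (1.6)] -/
theorem covOp_form_nonneg [Fintype X] [Fintype Y] [Fintype ι] [DecidableEq X] [DecidableEq ι]
    {c : X → X → ℝ} (hc : ∀ x y, 0 ≤ c x y) {m2 a : ℝ} (hm : 0 ≤ m2) (ha : 0 ≤ a) (q : Y → X → ℝ)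
    (W : X → X → Matrix ι ι ℝ) (T : Y → X → Matrix ι ι ℝ) (Φ : X × ι → ℝ) :
    0 ≤ Φ ⬝ᵥ (covOp c m2 a q W T *ᵥ Φ) := by
  rw [covOp_form, covLap_form, projOp_form]
  refine add_nonneg (add_nonneg ?_ (mul_nonneg hm (dotProduct_self_nonneg' Φ)))
    (mul_nonneg ha (dotProduct_self_nonneg' _))
  exact Finset.sum_nonneg fun x _ => Finset.sum_nonneg fun y _ =>
    mul_nonneg (hc x y) (dotProduct_self_nonneg' _)

/-- **THE ZERO MODES OF THE FORM OF (1.6)**: if `⟨Φ, (−Δ_W + m² + aQ*Q)Φ⟩ = 0` (`c ≥ 0`, `m² ≥ 0`, `a > 0`), then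
`φ` is COVARIANTLY CONSTANT along every positively weighted pair, `W(x,y)φ(y) = φ(x)`, and ALL covariant block
averages vanish, `Q Φ = 0`. [cite: Balaban1983RegularityDecay, p. 572 (1.3), (1.5), (1.6)] -/
theorem covOp_form_eq_zero [Fintype X] [Fintype Y] [Fintype ι] [DecidableEq X] [DecidableEq ι]
    {c : X → X → ℝ} (hc : ∀ x y, 0 ≤ c x y) {m2 a : ℝ} (hm : 0 ≤ m2) (ha : 0 < a) (q : Y → X → ℝ)
    (W : X → X → Matrix ι ι ℝ) (T : Y → X → Matrix ι ι ℝ) {Φ : X × ι → ℝ}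
    (h0 : Φ ⬝ᵥ (covOp c m2 a q W T *ᵥ Φ) = 0) :
    (∀ x y, 0 < c x y → W x y *ᵥ fld Φ y = fld Φ x) ∧ avgOp q T *ᵥ Φ = 0 := by
  rw [covOp_form, covLap_form, projOp_form] at h0
  have h1 : 0 ≤ ∑ x, ∑ y, c x y * ((W x y *ᵥ fld Φ y - fld Φ x) ⬝ᵥ (W x y *ᵥ fld Φ y - fld Φ x)) :=
    Finset.sum_nonneg fun x _ => Finset.sum_nonneg fun y _ => mul_nonneg (hc x y) (dotProduct_self_nonneg' _)
  have h2 : 0 ≤ m2 * (Φ ⬝ᵥ Φ) := mul_nonneg hm (dotProduct_self_nonneg' Φ)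
  have h3 : 0 ≤ a * ((avgOp q T *ᵥ Φ) ⬝ᵥ (avgOp q T *ᵥ Φ)) := mul_nonneg ha.le (dotProduct_self_nonneg' _)
  have e1 : ∑ x, ∑ y, c x y * ((W x y *ᵥ fld Φ y - fld Φ x) ⬝ᵥ (W x y *ᵥ fld Φ y - fld Φ x)) = 0 := by
    linarith
  have e3 : (avgOp q T *ᵥ Φ) ⬝ᵥ (avgOp q T *ᵥ Φ) = 0 := by
    have : a * ((avgOp q T *ᵥ Φ) ⬝ᵥ (avgOp q T *ᵥ Φ)) = 0 := by linarith
    rcases mul_eq_zero.1 this with h | h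
    · exact absurd h ha.ne'
    · exact h
  refine ⟨fun x y hxy => ?_, dotProduct_self_eq_zero.1 e3⟩
  have hx := (Finset.sum_eq_zero_iff_of_nonneg fun x' _ => Finset.sum_nonneg fun y' _ =>
    mul_nonneg (hc x' y') (dotProduct_self_nonneg' _)).1 e1 x (Finset.mem_univ x)
  have hxy' := (Finset.sum_eq_zero_iff_of_nonneg fun y' _ =>
    mul_nonneg (hc x y') (dotProduct_self_nonneg' _)).1 hx y (Finset.mem_univ y)
  rcases mul_eq_zero.1 hxy' with h | h
  · exact absurd h hxy.ne'
  · exact sub_eq_zero.1 (dotProduct_self_eq_zero.1 h)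

/-- **NO NON-TRIVIAL ZERO MODES**: under the geometric hypotheses — bond weights `c ≥ 0`, block weights `q ≥ 0`,
every site `x` carrying a positive weight `q(y,x) > 0` in SOME block `y`, the links orthogonal on positively weighted
pairs, and every weighted contour `Γ_{y,x}` (from the base point `emb y`) running through positively weighted pairs
and ENDING at `x` — the form of `H = −Δ_W + m² + a·Q*Q` (`a > 0`, `m² ≥ 0`, transporters `T = U(Γ_{y,x})`)
vanishes only at `Φ = 0`.  Mechanism: covariant constancy along `Γ_{y,x}` gives `U(Γ_{y,x})φ(x) = φ(emb y)`,
so `(QΦ)(y) = (Σ_x q(y,x))·φ(emb y) = 0` forces `φ(emb y) = 0`, and then `φ(x) = 0` since `U(Γ_{y,x})` is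
orthogonal. [cite: Balaban1983RegularityDecay, p. 572 (1.3)–(1.6)] -/
theorem eq_zero_of_covOp_form_eq_zero [Fintype X] [Fintype Y] [Fintype ι] [DecidableEq X] [DecidableEq ι]
    {c : X → X → ℝ} (hc : ∀ x y, 0 ≤ c x y) {m2 a : ℝ} (hm : 0 ≤ m2) (ha : 0 < a) {q : Y → X → ℝ}
    (hq : ∀ y x, 0 ≤ q y x) (hcov : ∀ x, ∃ y, 0 < q y x) {W : X → X → Matrix ι ι ℝ}
    (hW : ∀ x y, 0 < c x y → (W x y)ᵀ * W x y = 1) {emb : Y → X} {Γ : Y → X → List X}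
    (hpath : ∀ y x, q y x ≠ 0 → PathRel (fun u v => 0 < c u v) (emb y) (Γ y x))
    (hend : ∀ y x, q y x ≠ 0 → pathEnd (emb y) (Γ y x) = x) {Φ : X × ι → ℝ}
    (h0 : Φ ⬝ᵥ (covOp c m2 a q W (contourTrans W emb Γ) *ᵥ Φ) = 0) : Φ = 0 := by
  obtain ⟨hcc, hQ⟩ := covOp_form_eq_zero hc hm ha q W (contourTrans W emb Γ) h0
  -- transport along a weighted contour returns the value at the base point
  have htr : ∀ y x, q y x ≠ 0 → contourTrans W emb Γ y x *ᵥ fld Φ x = fld Φ (emb y) := by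
    intro y x hyx
    have h := transport_mulVec_eq_of_pathRel W (fld Φ) (emb y) (Γ y x)
      (pathRel_mono (fun u v huv => hcc u v huv) _ _ (hpath y x hyx))
    rwa [hend y x hyx] at h
  -- the block averages are multiples of the base-point values
  have hbase : ∀ y x, 0 < q y x → fld Φ (emb y) = 0 := by
    intro y x hyx
    have hQy : fld (avgOp q (contourTrans W emb Γ) *ᵥ Φ) y = 0 := by rw [hQ]; rfl
    rw [fld_avgOp_mulVec] at hQy
    have hsum : ∑ x', q y x' • (contourTrans W emb Γ y x' *ᵥ fld Φ x') = (∑ x', q y x') • fld Φ (emb y) := by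
      rw [Finset.sum_smul]
      refine Finset.sum_congr rfl fun x' _ => ?_
      by_cases h : q y x' = 0
      · rw [h, zero_smul, zero_smul]
      · rw [htr y x' h]
    rw [hsum] at hQy
    have hpos : 0 < ∑ x', q y x' :=
      lt_of_lt_of_le hyx (Finset.single_le_sum (fun x' _ => hq y x') (Finset.mem_univ x))
    rcases smul_eq_zero.1 hQy with h | h
    · exact absurd h hpos.ne'
    · exact h
  -- every site lies in some block: its value is killed by the orthogonal transporter
  refine eq_zero_of_fld_eq_zero fun x => ?_
  obtain ⟨y, hyx⟩ := hcov x
  have h1 : contourTrans W emb Γ y x *ᵥ fld Φ x = 0 := by rw [htr y x hyx.ne', hbase y x hyx]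
  refine eq_zero_of_orthogonal_mulVec_eq_zero ?_ h1
  exact transport_transpose_mul_self W (emb y) (Γ y x)
    (pathRel_mono (fun u v huv => hW u v huv) _ _ (hpath y x hyx.ne'))

/-- `H = −Δ_W + m² + a·Q*Q` is symmetric (Hermitian over `ℝ`). [cite: Balaban1983RegularityDecay, p. 572 (1.6)] -/
theorem covOp_isHermitian [Fintype X] [Fintype Y] [Fintype ι] [DecidableEq X] [DecidableEq ι] (c : X → X → ℝ)
    (m2 a : ℝ) (q : Y → X → ℝ) (W : X → X → Matrix ι ι ℝ) (T : Y → X → Matrix ι ι ℝ) :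
    (covOp c m2 a q W T).IsHermitian := by
  rw [Matrix.IsHermitian, Matrix.conjTranspose_eq_transpose_of_trivial]
  unfold covOp covLap projOp
  simp only [Matrix.transpose_add, Matrix.transpose_smul, Matrix.transpose_one, Matrix.transpose_sum,
    Matrix.transpose_mul, Matrix.transpose_transpose]

/-- **`H = −Δ_W + m² + a·Q*Q` IS POSITIVE DEFINITE** under the hypotheses of `eq_zero_of_covOp_form_eq_zero`.
[cite: Balaban1983RegularityDecay, p. 572 (1.6)] -/
theorem covOp_posDef [Fintype X] [Fintype Y] [Fintype ι] [DecidableEq X] [DecidableEq ι]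
    {c : X → X → ℝ} (hc : ∀ x y, 0 ≤ c x y) {m2 a : ℝ} (hm : 0 ≤ m2) (ha : 0 < a) {q : Y → X → ℝ}
    (hq : ∀ y x, 0 ≤ q y x) (hcov : ∀ x, ∃ y, 0 < q y x) {W : X → X → Matrix ι ι ℝ}
    (hW : ∀ x y, 0 < c x y → (W x y)ᵀ * W x y = 1) {emb : Y → X} {Γ : Y → X → List X}
    (hpath : ∀ y x, q y x ≠ 0 → PathRel (fun u v => 0 < c u v) (emb y) (Γ y x))
    (hend : ∀ y x, q y x ≠ 0 → pathEnd (emb y) (Γ y x) = x) :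
    (covOp c m2 a q W (contourTrans W emb Γ)).PosDef := by
  refine Matrix.PosDef.of_dotProduct_mulVec_pos (covOp_isHermitian _ _ _ _ _ _) fun Φ hΦ => ?_
  rw [star_trivial]
  rcases (covOp_form_nonneg hc hm ha.le q W (contourTrans W emb Γ) Φ).lt_or_eq with h | h
  · exact h
  · exact absurd (eq_zero_of_covOp_form_eq_zero hc hm ha hq hcov hW hpath hend h.symm) hΦ

end Generic

/-! ## §2 [B4]'s operator (1.6) for the link variables (1.2) `U(κA_b)` of an orthogonal flow: every `A`, every `κ` -/

section B4Objects

variable {X Y ι : Type*} [Fintype X] [Fintype Y] [Fintype ι] [DecidableEq X] [DecidableEq ι]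

/-- **`−Δ^{η,N}_{A,Ω} + m² + aP_k(A)` IS POSITIVE DEFINITE FOR EVERY VECTOR FIELD `A`** (weights `c ≥ 0`, `q ≥ 0`
covering the sites, weighted contours through positively weighted pairs ending at their target; `a > 0`, `m² ≥ 0`;
any orthogonal one-parameter flow `U`, any coupling `κ`). [cite: Balaban1983RegularityDecay, p. 572 (1.6)] -/
theorem b4Op_posDef (F : OrthFlow ι) (κ : ℝ) {c : X → X → ℝ} (hc : ∀ x y, 0 ≤ c x y) {m2 a : ℝ} (hm : 0 ≤ m2)
    (ha : 0 < a) {q : Y → X → ℝ} (hq : ∀ y x, 0 ≤ q y x) (hcov : ∀ x, ∃ y, 0 < q y x) {emb : Y → X}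
    {Γ : Y → X → List X} (hpath : ∀ y x, q y x ≠ 0 → PathRel (fun u v => 0 < c u v) (emb y) (Γ y x))
    (hend : ∀ y x, q y x ≠ 0 → pathEnd (emb y) (Γ y x) = x) (A : X → X → ℝ) :
    (b4Op F κ c m2 a q emb Γ A).PosDef :=
  covOp_posDef hc hm ha hq hcov (fun x y _ => fieldLink_orth F κ A x y) hpath hend

/-- … hence INVERTIBLE, for every `A`. [cite: Balaban1983RegularityDecay, p. 572 (1.6)] -/
theorem b4Op_isUnit (F : OrthFlow ι) (κ : ℝ) {c : X → X → ℝ} (hc : ∀ x y, 0 ≤ c x y) {m2 a : ℝ} (hm : 0 ≤ m2)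
    (ha : 0 < a) {q : Y → X → ℝ} (hq : ∀ y x, 0 ≤ q y x) (hcov : ∀ x, ∃ y, 0 < q y x) {emb : Y → X}
    {Γ : Y → X → List X} (hpath : ∀ y x, q y x ≠ 0 → PathRel (fun u v => 0 < c u v) (emb y) (Γ y x))
    (hend : ∀ y x, q y x ≠ 0 → pathEnd (emb y) (Γ y x) = x) (A : X → X → ℝ) :
    IsUnit (b4Op F κ c m2 a q emb Γ A) :=
  (b4Op_posDef F κ hc hm ha hq hcov hpath hend A).isUnit

/-- **`G_k(Ω, A)·(−Δ^{η,N}_{A,Ω} + m² + aP_k(A)) = 1` FOR EVERY `A`.** [cite: Balaban1983RegularityDecay, p. 572 (1.6)] -/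
theorem b4Green_mul_b4Op (F : OrthFlow ι) (κ : ℝ) {c : X → X → ℝ} (hc : ∀ x y, 0 ≤ c x y) {m2 a : ℝ}
    (hm : 0 ≤ m2) (ha : 0 < a) {q : Y → X → ℝ} (hq : ∀ y x, 0 ≤ q y x) (hcov : ∀ x, ∃ y, 0 < q y x)
    {emb : Y → X} {Γ : Y → X → List X}
    (hpath : ∀ y x, q y x ≠ 0 → PathRel (fun u v => 0 < c u v) (emb y) (Γ y x))
    (hend : ∀ y x, q y x ≠ 0 → pathEnd (emb y) (Γ y x) = x) (A : X → X → ℝ) :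
    b4Green F κ c m2 a q emb Γ A * b4Op F κ c m2 a q emb Γ A = 1 :=
  Matrix.nonsing_inv_mul _
    ((Matrix.isUnit_iff_isUnit_det _).1 (b4Op_isUnit F κ hc hm ha hq hcov hpath hend A))

/-- **`(−Δ^{η,N}_{A,Ω} + m² + aP_k(A))·G_k(Ω, A) = 1` FOR EVERY `A`.** [cite: Balaban1983RegularityDecay, p. 572 (1.6)] -/
theorem b4Op_mul_b4Green (F : OrthFlow ι) (κ : ℝ) {c : X → X → ℝ} (hc : ∀ x y, 0 ≤ c x y) {m2 a : ℝ}
    (hm : 0 ≤ m2) (ha : 0 < a) {q : Y → X → ℝ} (hq : ∀ y x, 0 ≤ q y x) (hcov : ∀ x, ∃ y, 0 < q y x)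
    {emb : Y → X} {Γ : Y → X → List X}
    (hpath : ∀ y x, q y x ≠ 0 → PathRel (fun u v => 0 < c u v) (emb y) (Γ y x))
    (hend : ∀ y x, q y x ≠ 0 → pathEnd (emb y) (Γ y x) = x) (A : X → X → ℝ) :
    b4Op F κ c m2 a q emb Γ A * b4Green F κ c m2 a q emb Γ A = 1 :=
  Matrix.mul_nonsing_inv _
    ((Matrix.isUnit_iff_isUnit_det _).1 (b4Op_isUnit F κ hc hm ha hq hcov hpath hend A))

/-- `G_k(Ω, A)` is positive definite, for every `A`. [cite: Balaban1983RegularityDecay, p. 572 (1.6)] -/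
theorem b4Green_posDef (F : OrthFlow ι) (κ : ℝ) {c : X → X → ℝ} (hc : ∀ x y, 0 ≤ c x y) {m2 a : ℝ}
    (hm : 0 ≤ m2) (ha : 0 < a) {q : Y → X → ℝ} (hq : ∀ y x, 0 ≤ q y x) (hcov : ∀ x, ∃ y, 0 < q y x)
    {emb : Y → X} {Γ : Y → X → List X}
    (hpath : ∀ y x, q y x ≠ 0 → PathRel (fun u v => 0 < c u v) (emb y) (Γ y x))
    (hend : ∀ y x, q y x ≠ 0 → pathEnd (emb y) (Γ y x) = x) (A : X → X → ℝ) :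
    (b4Green F κ c m2 a q emb Γ A).PosDef :=
  (b4Op_posDef F κ hc hm ha hq hcov hpath hend A).inv

end B4Objects

/-! ## §3 (1.6) on every finite union of unit blocks, [B4]'s weights and staircase contours: all hypotheses discharged -/

section Region

open Literature.MathematicalPhysics.QuantumFieldTheory.Balaban1983to89.B4Reflection242 (blk nbrs)
open Literature.MathematicalPhysics.QuantumFieldTheory.Balaban1983to89.B4Lower18 (fineDom mem_fineDom)

variable {d : ℕ} {ι : Type*} [Fintype ι] [DecidableEq ι]

/-- every fine point `x ∈ Ω = ⋃_{y∈Ωc} B(y)` lies in the block of its label `blk n x ∈ Ωc`, with block weight `1`.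
[cite: Balaban1983RegularityDecay, p. 572 (1.1), (1.4)] -/
theorem rBlkWt_cover {n : ℕ} (hn : 1 ≤ n) (Ωc : Finset (Fin (d + 1) → ℤ)) (x : ↥(fineDom n Ωc)) :
    ∃ y : ↥Ωc, 0 < rBlkWt n Ωc (fineDom n Ωc) y x :=
  ⟨⟨blk n x.1, (mem_fineDom hn).1 x.2⟩, by simp [rBlkWt]⟩

/-- the staircase contour `Γ_{y,x}` of a weighted pair runs through Neumann bonds of `Ω` (positive weight `n²/2`).
[cite: Balaban1983RegularityDecay, p. 572 (1.3), (1.4)] -/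
theorem rstairContour_weighted {n : ℕ} (hn : 1 ≤ n) (Ωc : Finset (Fin (d + 1) → ℤ)) (y : ↥Ωc)
    (x : ↥(fineDom n Ωc)) :
    PathRel (fun u v : ↥(fineDom n Ωc) => 0 < regWt n (fineDom n Ωc) u v) (rbaseEmb hn Ωc y)
      (rstairContour hn Ωc y x) := by
  refine pathRel_mono (fun u v huv => ?_) _ _ (rstairContour_path hn Ωc y x)
  have hn' : (0 : ℝ) < n := by exact_mod_cast hn
  simp only [regWt, if_pos huv.1, mul_one]
  positivity

/-- **(1.6) IS WELL POSED FOR EVERY CONFIGURATION**: on every finite union `Ω = fineDom n Ωc` of unit blocks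
(`n = L^k = η^{-1} ≥ 1`), with [B4]'s Neumann bond weights, block weights, base points and staircase contours, the
operator `−Δ^{η,N}_{A,Ω} + m² + aP_k(A)` is POSITIVE DEFINITE for every bond function `A`, every orthogonal
one-parameter flow `U`, every coupling `κ`, every `a > 0` and every `m² ≥ 0`.
[cite: Balaban1983RegularityDecay, p. 572 (1.6)] -/
theorem b4Op_region_posDef (F : OrthFlow ι) (κ : ℝ) {n : ℕ} (hn : 1 ≤ n) {a : ℝ} (ha : 0 < a) {m2 : ℝ}
    (hm : 0 ≤ m2) (Ωc : Finset (Fin (d + 1) → ℤ)) (A : ↥(fineDom n Ωc) → ↥(fineDom n Ωc) → ℝ) :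
    (b4Op F κ (regWt n (fineDom n Ωc)) m2 (a * ((n : ℝ) ^ (d + 1))⁻¹) (rBlkWt n Ωc (fineDom n Ωc))
      (rbaseEmb hn Ωc) (rstairContour hn Ωc) A).PosDef := by
  have hn' : (0 : ℝ) < n := by exact_mod_cast hn
  exact b4Op_posDef F κ (regWt_nonneg n _) hm (by positivity) (rBlkWt_nonneg n Ωc _) (rBlkWt_cover hn Ωc)
    (fun y x _ => rstairContour_weighted hn Ωc y x) (fun y x h => rstairContour_end hn Ωc y x h) A

/-- the quadratic form of (1.6) is STRICTLY positive on every non-zero field, for every configuration `A`.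
[cite: Balaban1983RegularityDecay, p. 572 (1.6)] -/
theorem b4Op_region_form_pos (F : OrthFlow ι) (κ : ℝ) {n : ℕ} (hn : 1 ≤ n) {a : ℝ} (ha : 0 < a) {m2 : ℝ}
    (hm : 0 ≤ m2) (Ωc : Finset (Fin (d + 1) → ℤ)) (A : ↥(fineDom n Ωc) → ↥(fineDom n Ωc) → ℝ)
    {Φ : ↥(fineDom n Ωc) × ι → ℝ} (hΦ : Φ ≠ 0) :
    0 < Φ ⬝ᵥ (b4Op F κ (regWt n (fineDom n Ωc)) m2 (a * ((n : ℝ) ^ (d + 1))⁻¹) (rBlkWt n Ωc (fineDom n Ωc))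
      (rbaseEmb hn Ωc) (rstairContour hn Ωc) A *ᵥ Φ) := by
  have h := (b4Op_region_posDef F κ hn ha hm Ωc A).dotProduct_mulVec_pos hΦ
  rwa [star_trivial] at h

/-- **`−Δ^{η,N}_{A,Ω} + m² + aP_k(A)` IS INVERTIBLE FOR EVERY `A`** on every finite union of unit blocks.
[cite: Balaban1983RegularityDecay, p. 572 (1.6)] -/
theorem b4Op_region_isUnit (F : OrthFlow ι) (κ : ℝ) {n : ℕ} (hn : 1 ≤ n) {a : ℝ} (ha : 0 < a) {m2 : ℝ}
    (hm : 0 ≤ m2) (Ωc : Finset (Fin (d + 1) → ℤ)) (A : ↥(fineDom n Ωc) → ↥(fineDom n Ωc) → ℝ) :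
    IsUnit (b4Op F κ (regWt n (fineDom n Ωc)) m2 (a * ((n : ℝ) ^ (d + 1))⁻¹) (rBlkWt n Ωc (fineDom n Ωc))
      (rbaseEmb hn Ωc) (rstairContour hn Ωc) A) :=
  (b4Op_region_posDef F κ hn ha hm Ωc A).isUnit

/-- **THE GREEN'S FUNCTION `G_k(Ω, A)` OF (1.6) EXISTS FOR EVERY `A`: `G_k(Ω,A)·(−Δ^{η,N}_{A,Ω} + m² + aP_k(A)) = 1`**
on every finite union of unit blocks, `a > 0`, `m² ≥ 0`. [cite: Balaban1983RegularityDecay, p. 572 (1.6)] -/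
theorem b4Green_region_mul_b4Op (F : OrthFlow ι) (κ : ℝ) {n : ℕ} (hn : 1 ≤ n) {a : ℝ} (ha : 0 < a) {m2 : ℝ}
    (hm : 0 ≤ m2) (Ωc : Finset (Fin (d + 1) → ℤ)) (A : ↥(fineDom n Ωc) → ↥(fineDom n Ωc) → ℝ) :
    b4Green F κ (regWt n (fineDom n Ωc)) m2 (a * ((n : ℝ) ^ (d + 1))⁻¹) (rBlkWt n Ωc (fineDom n Ωc))
        (rbaseEmb hn Ωc) (rstairContour hn Ωc) A
      * b4Op F κ (regWt n (fineDom n Ωc)) m2 (a * ((n : ℝ) ^ (d + 1))⁻¹) (rBlkWt n Ωc (fineDom n Ωc))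
        (rbaseEmb hn Ωc) (rstairContour hn Ωc) A = 1 :=
  Matrix.nonsing_inv_mul _ ((Matrix.isUnit_iff_isUnit_det _).1 (b4Op_region_isUnit F κ hn ha hm Ωc A))

/-- … and `(−Δ^{η,N}_{A,Ω} + m² + aP_k(A))·G_k(Ω, A) = 1`. [cite: Balaban1983RegularityDecay, p. 572 (1.6)] -/
theorem b4Op_region_mul_b4Green (F : OrthFlow ι) (κ : ℝ) {n : ℕ} (hn : 1 ≤ n) {a : ℝ} (ha : 0 < a) {m2 : ℝ}
    (hm : 0 ≤ m2) (Ωc : Finset (Fin (d + 1) → ℤ)) (A : ↥(fineDom n Ωc) → ↥(fineDom n Ωc) → ℝ) :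
    b4Op F κ (regWt n (fineDom n Ωc)) m2 (a * ((n : ℝ) ^ (d + 1))⁻¹) (rBlkWt n Ωc (fineDom n Ωc))
        (rbaseEmb hn Ωc) (rstairContour hn Ωc) A
      * b4Green F κ (regWt n (fineDom n Ωc)) m2 (a * ((n : ℝ) ^ (d + 1))⁻¹) (rBlkWt n Ωc (fineDom n Ωc))
        (rbaseEmb hn Ωc) (rstairContour hn Ωc) A = 1 :=
  Matrix.mul_nonsing_inv _ ((Matrix.isUnit_iff_isUnit_det _).1 (b4Op_region_isUnit F κ hn ha hm Ωc A))

/-- `Φ = G_k(Ω, A)f` SOLVES `(−Δ^{η,N}_{A,Ω} + m² + aP_k(A))Φ = f`, for every `A` and every source `f`.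
[cite: Balaban1983RegularityDecay, p. 572 (1.6)] -/
theorem b4Op_region_mulVec_b4Green (F : OrthFlow ι) (κ : ℝ) {n : ℕ} (hn : 1 ≤ n) {a : ℝ} (ha : 0 < a) {m2 : ℝ}
    (hm : 0 ≤ m2) (Ωc : Finset (Fin (d + 1) → ℤ)) (A : ↥(fineDom n Ωc) → ↥(fineDom n Ωc) → ℝ)
    (f : ↥(fineDom n Ωc) × ι → ℝ) :
    b4Op F κ (regWt n (fineDom n Ωc)) m2 (a * ((n : ℝ) ^ (d + 1))⁻¹) (rBlkWt n Ωc (fineDom n Ωc))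
        (rbaseEmb hn Ωc) (rstairContour hn Ωc) A
      *ᵥ (b4Green F κ (regWt n (fineDom n Ωc)) m2 (a * ((n : ℝ) ^ (d + 1))⁻¹) (rBlkWt n Ωc (fineDom n Ωc))
        (rbaseEmb hn Ωc) (rstairContour hn Ωc) A *ᵥ f) = f := by
  rw [Matrix.mulVec_mulVec, b4Op_region_mul_b4Green F κ hn ha hm Ωc A, Matrix.one_mulVec]

/-- … and it is the ONLY solution: `G_k(Ω, A)((−Δ^{η,N}_{A,Ω} + m² + aP_k(A))Φ) = Φ`.
[cite: Balaban1983RegularityDecay, p. 572 (1.6)] -/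
theorem b4Green_region_mulVec_b4Op (F : OrthFlow ι) (κ : ℝ) {n : ℕ} (hn : 1 ≤ n) {a : ℝ} (ha : 0 < a) {m2 : ℝ}
    (hm : 0 ≤ m2) (Ωc : Finset (Fin (d + 1) → ℤ)) (A : ↥(fineDom n Ωc) → ↥(fineDom n Ωc) → ℝ)
    (Φ : ↥(fineDom n Ωc) × ι → ℝ) :
    b4Green F κ (regWt n (fineDom n Ωc)) m2 (a * ((n : ℝ) ^ (d + 1))⁻¹) (rBlkWt n Ωc (fineDom n Ωc))
        (rbaseEmb hn Ωc) (rstairContour hn Ωc) A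
      *ᵥ (b4Op F κ (regWt n (fineDom n Ωc)) m2 (a * ((n : ℝ) ^ (d + 1))⁻¹) (rBlkWt n Ωc (fineDom n Ωc))
        (rbaseEmb hn Ωc) (rstairContour hn Ωc) A *ᵥ Φ) = Φ := by
  rw [Matrix.mulVec_mulVec, b4Green_region_mul_b4Op F κ hn ha hm Ωc A, Matrix.one_mulVec]

/-- `G_k(Ω, A)` is positive definite (in particular symmetric with `⟨f, G_k(Ω,A)f⟩ > 0` for `f ≠ 0`), for every `A`.
[cite: Balaban1983RegularityDecay, p. 572 (1.6)] -/
theorem b4Green_region_posDef (F : OrthFlow ι) (κ : ℝ) {n : ℕ} (hn : 1 ≤ n) {a : ℝ} (ha : 0 < a) {m2 : ℝ}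
    (hm : 0 ≤ m2) (Ωc : Finset (Fin (d + 1) → ℤ)) (A : ↥(fineDom n Ωc) → ↥(fineDom n Ωc) → ℝ) :
    (b4Green F κ (regWt n (fineDom n Ωc)) m2 (a * ((n : ℝ) ^ (d + 1))⁻¹) (rBlkWt n Ωc (fineDom n Ωc))
      (rbaseEmb hn Ωc) (rstairContour hn Ωc) A).PosDef :=
  (b4Op_region_posDef F κ hn ha hm Ωc A).inv

end Region

end Literature.MathematicalPhysics.QuantumFieldTheory.Balaban1983to89.B4Eq16GreenExists
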